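import Mathlib
import Summits.NavierStokesRegularity.NavierStokesRegularity.Theorems.EulerZoomLiouvillePowerGaugeEulerLiouvilleGalileanWanderingSlices
import Summits.NavierStokesRegularity.NavierStokesRegularity.Theorems.EulerZoomLiouvillePowerGaugeEulerLiouvilleGalileanWanderingPairing
import HarnessLib

/-!
# Crux E `PowerGaugeEulerLiouville` (stmt-NavierStokesRegularity-19832), line `galilean-frames` (ns-idea-11 g6/g7), stub F3
# `stub_wanderingReduce`, step (i): THE DRIFTED WEAK PROFILE EQUATION OF A WANDERING SELF-SIMILAR MEMBER (width seat ns-ezl-w3 g5)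

Route №10 `EulerZoomLiouville` (NavierStokesRegularity), crux E.  A WANDERING self-similar member of a distributional Euler pair on
`(−∞,0) × ℝ³` — `u(τ, y) = (T−τ)^{γ−1} V((T−τ)^{−γ}(y − ξ(τ)))` for `τ < T₁` (`T₁ ≤ 0`, `T₁ ≤ T`, `ξ ∈ C¹`, `0 < γ ≤ 1`, no background), with
`V, |V|² ∈ L¹_loc` — satisfies, for every divergence-free test field `Ψ` and EVERY `τ < T₁`, the DRIFTED weak profile equation

  `∫⟪V, DΨ·V⟫ + (4γ−1)∫⟪V, Ψ⟫ + γ∫⟪V(Y), DΨ(Y)·Y⟫ = (T−τ)^{1−γ} ∫⟪V, DΨ·ξ'(τ)⟫`     (`wandering_profile_identity`)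

(the anchored case `ξ' = 0` is the lineage's `ProfileEquation.weak_profile_equation` tested with divergence-free fields).  Consequences:
* `wandering_drift_weaklyGradient` — the left side does not depend on `τ`, so `∫⟪V, DΨ·((T−τ₁)^{1−γ}ξ'(τ₁) − (T−τ₂)^{1−γ}ξ'(τ₂))⟫ = 0`:
  the derivative of the profile along every increment of the SIMILARITY DRIFT `d(τ) = (T−τ)^{1−γ}ξ'(τ)` is weakly a gradient — the
  hypothesis of the line's first lemma `GalileanFrames.harmonicShearVanishes`;
* `wandering_profile_integral_inner_gradient_eq_zero` — the profile is weakly divergence free.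
Method: the member-level tensor tests of `…GalileanTensorTest` + the slice change of variables `y = ξ(τ) + (T−τ)^γ Y` + dominated
differentiation (`…GalileanWanderingPairing`) + by parts and the fundamental lemma in `τ`; no co-moving test fields, `ξ ∈ C¹` suffices.

WHAT THIS IS NOT: not NS regularity, not the crux E, not yet F3 — slice identities of one stratum of the crux CLASS 19832 (MODEL lattice;
E/NS strata), `--supports` stmt-19832; 19832 OPEN. [folklore; ChaeShvydkoy2013 §2.1 eq. (2.1) (profile equation); MajdaBertozzi2002 Prop. 1.1]
-/

noncomputable section

-- flat `Theorems/<Route><Decl>…` files of one crux share the namespace of the crux (tree convention: `Summit.<S>.<S>.…`)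
set_option linter.dupNamespace false

open MeasureTheory Set Filter Topology Metric Function TopologicalSpace InnerProductSpace
open scoped ENNReal NNReal RealInnerProductSpace ContDiff

namespace Summit.NavierStokesRegularity.NavierStokesRegularity.Theorems.PowerGaugeEulerLiouville

namespace GalileanFrames

open Literature.Analysis Literature.Analysis.FunctionSpaces Literature.Analysis.FluidPDE
open Summit.NavierStokesRegularity.NavierStokesRegularity.Theorems.PowerGaugeEulerLiouville

variable {V : EuclideanSpace ℝ (Fin 3) → EuclideanSpace ℝ (Fin 3)} {ξ : ℝ → EuclideanSpace ℝ (Fin 3)} {γ T T₁ : ℝ}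

/-! ### The tested identity of a wandering member -/

section Member

variable {u : ℝ → EuclideanSpace ℝ (Fin 3) → EuclideanSpace ℝ (Fin 3)} {p : ℝ → EuclideanSpace ℝ (Fin 3) → ℝ}

/-- **THE TESTED MOMENTUM IDENTITY OF A WANDERING MEMBER, IN THE SIMILARITY FRAME** (shifted form, at every `τ < T₁`): for a divergence-free
test field `Φ`, with `G(τ) = ∫⟪V, Φ(ξ(τ) + (T−τ)^γ ·)⟫`, `G'` its derivative and `M(τ) = ∫⟪V(Y), DΦ(ξ(τ) + (T−τ)^γ Y) V(Y)⟫ dY`: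
`(T−τ)^{5γ−2} M(τ) = −(4γ−1)(T−τ)^{4γ−2} G(τ) + (T−τ)^{4γ−1} G'(τ)` (i.e. `N = f'` for the member-level pairings). [folklore] -/
theorem wandering_tested_identity
    (hsol : IsDistributionalNSSolutionOn (slab (EuclideanSpace ℝ (Fin 3)) (Iio 0) isOpen_Iio) 0 0 u p)
    (hT₁ : T₁ ≤ 0) (hT : T₁ ≤ T) (hγ : 0 < γ) (hγ1 : γ ≤ 1) (hξ : ContDiff ℝ 1 ξ)
    (hVm : AEStronglyMeasurable V volume) (hV : LocallyIntegrable V volume)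
    (hV2 : LocallyIntegrable (fun z => ‖V z‖ ^ 2) volume)
    (hu : ∀ τ : ℝ, τ < T₁ → u τ = fun y => (T - τ) ^ (γ - 1) • V ((T - τ) ^ (-γ) • (y - ξ τ)))
    {Φ : EuclideanSpace ℝ (Fin 3) → EuclideanSpace ℝ (Fin 3)} (hΦ : IsTestFunctionOn (⊤ : Opens (EuclideanSpace ℝ (Fin 3))) Φ)
    (hdiv : ∀ z, VectorCalculus.divergence Φ z = 0) {τ : ℝ} (hτ : τ < T₁) :
    (T - τ) ^ (5 * γ - 2) * ∫ Y, ⟪V Y, (fderiv ℝ Φ (ξ τ + (T - τ) ^ γ • Y)) (V Y)⟫ =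
      -(1 : ℝ) * (4 * γ - 1) * (T - τ) ^ (4 * γ - 1 - 1) * (∫ Y, ⟪V Y, Φ (ξ τ + (T - τ) ^ γ • Y)⟫) +
        (T - τ) ^ (4 * γ - 1) *
          ∫ Y, ⟪V Y, (fderiv ℝ Φ (ξ τ + (T - τ) ^ γ • Y)) (deriv ξ τ + (-(γ * (T - τ) ^ (γ - 1))) • Y)⟫ := by
  have hΦc : Continuous Φ := hΦ.contDiff.continuous
  have hDΦc : Continuous (fderiv ℝ Φ) := hΦ.contDiff.continuous_fderiv (by simp)
  have hDΦs : HasCompactSupport (fderiv ℝ Φ) := hΦ.hasCompactSupport.fderiv (𝕜 := ℝ)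
  have hξc : Continuous ξ := hξ.continuous
  have hξ'c : Continuous (deriv ξ) := hξ.continuous_deriv le_rfl
  -- the pairings in the similarity frame
  set G : ℝ → ℝ := fun t => ∫ Y, ⟪V Y, Φ (ξ t + (T - t) ^ γ • Y)⟫ with hG
  set G' : ℝ → ℝ := fun t => ∫ Y, ⟪V Y, (fderiv ℝ Φ (ξ t + (T - t) ^ γ • Y)) (deriv ξ t + (-(γ * (T - t) ^ (γ - 1))) • Y)⟫
    with hG'
  set M : ℝ → ℝ := fun t => ∫ Y, ⟪V Y, (fderiv ℝ Φ (ξ t + (T - t) ^ γ • Y)) (V Y)⟫ with hM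
  -- the member-level pairings
  set f : ℝ → ℝ := fun t => ∫ y, ⟪u t y, Φ y⟫ with hf
  set N : ℝ → ℝ := fun t => ∫ y, ⟪u t y, (fderiv ℝ Φ y) (u t y)⟫ with hN
  set g : ℝ → ℝ := fun t => -(1 : ℝ) * (4 * γ - 1) * (T - t) ^ (4 * γ - 1 - 1) * G t + (T - t) ^ (4 * γ - 1) * G' t with hg
  -- slices
  have hfF : ∀ t, t < T₁ → f t = (T - t) ^ (4 * γ - 1) * G t := fun t ht => by
    simp only [hf, hG]
    rw [hu t ht]
    exact integral_inner_wanderingSlice (ht.trans_le hT) (ξ t) Φ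
  have hNM : ∀ t, t < T₁ → N t = (T - t) ^ (5 * γ - 2) * M t := fun t ht => by
    simp only [hN, hM]
    rw [hu t ht]
    exact integral_inner_clm_wanderingSlice (ht.trans_le hT) (ξ t) (fderiv ℝ Φ)
  -- derivative of `f` on the window
  have hderiv : ∀ t, t < T₁ → HasDerivAt f (g t) t := by
    intro t ht
    have htT : t < T := ht.trans_le hT
    have hW : HasDerivAt (fun s : ℝ => (T - s) ^ (4 * γ - 1)) (-(1 : ℝ) * (4 * γ - 1) * (T - t) ^ (4 * γ - 1 - 1)) t := by
      have h := ((hasDerivAt_id t).const_sub T).rpow_const (p := 4 * γ - 1) (Or.inl (by simp only [id]; linarith))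
      simpa only [id] using h
    have hGd : HasDerivAt G (G' t) t := hasDerivAt_wanderingPairing hV hξ hγ hγ1 hΦ htT
    have hF : HasDerivAt (fun s => (T - s) ^ (4 * γ - 1) * G s) (g t) t := by
      have h := hW.mul hGd
      simp only [hg]
      exact h
    refine hF.congr_of_eventuallyEq ?_
    filter_upwards [isOpen_Iio.mem_nhds ht] with s hs
    exact hfF s hs
  -- continuity of `g` and `N` on the window
  have hpow : ∀ c : ℝ, ContinuousOn (fun s : ℝ => (T - s) ^ c) (Iio T) := fun c s hs =>
    ((continuousAt_const.sub continuousAt_id).rpow_const (Or.inl (sub_pos.2 (show s < T from hs)).ne')).continuousWithinAt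
  have hGc : ContinuousOn G (Iio T) := fun s hs =>
    (hasDerivAt_wanderingPairing hV hξ hγ hγ1 hΦ (show s < T from hs)).continuousAt.continuousWithinAt
  have hG'c : ContinuousOn G' (Iio T) :=
    continuousOn_wanderingPairing_clm hV hξc hγ hγ1 hDΦc hDΦs hξ'c
      (d := fun s => -(γ * (T - s) ^ (γ - 1))) (((hpow (γ - 1)).const_smul γ).neg.congr (fun s _ => by simp [smul_eq_mul]))
  have hgc : ContinuousOn g (Iio T₁) :=
    ((((continuousOn_const.mul (hpow _)).mul hGc).add ((hpow _).mul hG'c))).mono (Iio_subset_Iio hT)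
  have hMc : ContinuousOn M (Iio T) := continuousOn_wanderingPairing_clm_self hVm hV2 hξc hγ hγ1 hDΦc hDΦs
  have hNc : ContinuousOn N (Iio T₁) :=
    (((hpow _).mul hMc).mono (Iio_subset_Iio hT)).congr fun s hs => hNM s hs
  -- the tensor identity for every admissible `χ`
  have htensor : ∀ χ : ℝ → ℝ, ContDiff ℝ (⊤ : ℕ∞) χ → HasCompactSupport χ → tsupport χ ⊆ Iio T₁ →
      ∫ t, (deriv χ t * f t + χ t * N t) = 0 := by
    intro χ hχ hχc hχT
    refine integral_tensorTest hsol hΦ hdiv hχ hχc (hχT.trans (Iio_subset_Iio hT₁)) (fun t ht => ?_) (fun t ht => ?_)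
    · have htT₁ : t < T₁ := hχT ht
      rw [hu t htT₁]
      exact integrable_inner_of_locallyIntegrable_of_hasCompactSupport
        (locallyIntegrable_wanderingSlice hV (htT₁.trans_le hT) (ξ t)) hΦc hΦ.hasCompactSupport
    · have htT₁ : t < T₁ := hχT ht
      rw [hu t htT₁]
      have hUl := locallyIntegrable_wanderingSlice (γ := γ) hV (htT₁.trans_le hT) (ξ t)
      have h := integrable_inner_clm_comp_add_self hUl.aestronglyMeasurable
        (locallyIntegrable_norm_sq_wanderingSlice (γ := γ) hV2 (htT₁.trans_le hT) (ξ t)) hDΦc hDΦs 0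
      simpa only [add_zero] using h
  have key := eq_of_integral_deriv_mul_add_eq_zero_Iio hderiv hgc hNc htensor hτ
  rw [hNM τ hτ] at key
  simp only [hg] at key
  exact key

/-- **THE DRIFTED WEAK PROFILE EQUATION OF A WANDERING MEMBER** (at every `τ < T₁`): for every divergence-free test field `Ψ`,
`∫⟪V, DΨ·V⟫ + (4γ−1)∫⟪V, Ψ⟫ + γ∫⟪V(Y), DΨ(Y)·Y⟫ = (T−τ)^{1−γ} ∫⟪V, DΨ·ξ'(τ)⟫` — the profile equation
`(1−γ)V + γ(Y·∇)V + (V·∇)V + ∇P = (T−τ)^{1−γ}(ξ'(τ)·∇)V` tested with `Ψ`. [folklore; cf. ChaeShvydkoy2013 §2.1 eq. (2.1)] -/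
theorem wandering_profile_identity
    (hsol : IsDistributionalNSSolutionOn (slab (EuclideanSpace ℝ (Fin 3)) (Iio 0) isOpen_Iio) 0 0 u p)
    (hT₁ : T₁ ≤ 0) (hT : T₁ ≤ T) (hγ : 0 < γ) (hγ1 : γ ≤ 1) (hξ : ContDiff ℝ 1 ξ)
    (hVm : AEStronglyMeasurable V volume) (hV : LocallyIntegrable V volume)
    (hV2 : LocallyIntegrable (fun z => ‖V z‖ ^ 2) volume)
    (hu : ∀ τ : ℝ, τ < T₁ → u τ = fun y => (T - τ) ^ (γ - 1) • V ((T - τ) ^ (-γ) • (y - ξ τ)))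
    {Ψ : EuclideanSpace ℝ (Fin 3) → EuclideanSpace ℝ (Fin 3)} (hΨ : IsTestFunctionOn (⊤ : Opens (EuclideanSpace ℝ (Fin 3))) Ψ)
    (hdiv : ∀ z, VectorCalculus.divergence Ψ z = 0) {τ : ℝ} (hτ : τ < T₁) :
    (∫ Y, ⟪V Y, (fderiv ℝ Ψ Y) (V Y)⟫) + (4 * γ - 1) * (∫ Y, ⟪V Y, Ψ Y⟫) + γ * ∫ Y, ⟪V Y, (fderiv ℝ Ψ Y) Y⟫ =
      (T - τ) ^ (1 - γ) * ∫ Y, ⟪V Y, (fderiv ℝ Ψ Y) (deriv ξ τ)⟫ := by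
  have hl : 0 < T - τ := by linarith
  set c : ℝ := (T - τ) ^ (-γ) with hc
  have hcs : c = ((T - τ) ^ γ)⁻¹ := Real.rpow_neg hl.le γ
  have hspos : 0 < (T - τ) ^ γ := Real.rpow_pos_of_pos hl _
  have hc0 : c ≠ 0 := by rw [hcs]; exact inv_ne_zero hspos.ne'
  have hΨd : Differentiable ℝ Ψ := hΨ.contDiff.differentiable (by simp)
  have hDΨc : Continuous (fderiv ℝ Ψ) := hΨ.contDiff.continuous_fderiv (by simp)
  have hDΨs : HasCompactSupport (fderiv ℝ Ψ) := hΨ.hasCompactSupport.fderiv (𝕜 := ℝ)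
  -- the pulled-back test field
  set Φ : EuclideanSpace ℝ (Fin 3) → EuclideanSpace ℝ (Fin 3) := fun y => Ψ (c • (y - ξ τ)) with hΦdef
  have hΦ : IsTestFunctionOn (⊤ : Opens (EuclideanSpace ℝ (Fin 3))) Φ := isTestFunctionOn_comp_smul_sub hΨ hc0 (ξ τ)
  have hDΦ : ∀ y, fderiv ℝ Φ y = c • fderiv ℝ Ψ (c • (y - ξ τ)) := fun y => fderiv_comp_smul_sub hΨd c (ξ τ) y
  have hdivΦ : ∀ z, VectorCalculus.divergence Φ z = 0 := fun z => by
    unfold VectorCalculus.divergence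
    rw [hDΦ z, ContinuousLinearMap.toLinearMap_smul, map_smul]
    change c • VectorCalculus.divergence Ψ (c • (z - ξ τ)) = 0
    rw [hdiv, smul_zero]
  -- evaluation at frame points
  have hpt : ∀ Y : EuclideanSpace ℝ (Fin 3), c • (ξ τ + (T - τ) ^ γ • Y - ξ τ) = Y := fun Y => by
    rw [add_sub_cancel_left, smul_smul, hcs, inv_mul_cancel₀ hspos.ne', one_smul]
  have hΦpt : ∀ Y : EuclideanSpace ℝ (Fin 3), Φ (ξ τ + (T - τ) ^ γ • Y) = Ψ Y := fun Y => by
    simp only [hΦdef, hpt]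
  have hDΦpt : ∀ Y : EuclideanSpace ℝ (Fin 3), fderiv ℝ Φ (ξ τ + (T - τ) ^ γ • Y) = c • fderiv ℝ Ψ Y := fun Y => by
    rw [hDΦ, hpt]
  -- the tested identity with `Φ`
  have key := wandering_tested_identity hsol hT₁ hT hγ hγ1 hξ hVm hV hV2 hu hΦ hdivΦ hτ
  simp only [hΦpt, hDΦpt, smul_apply, real_inner_smul_right] at key
  -- split the derivative pairing
  have i₁ : Integrable (fun Y => ⟪V Y, (fderiv ℝ Ψ Y) (deriv ξ τ)⟫) volume :=
    integrable_inner_of_locallyIntegrable_of_hasCompactSupport hV (hDΨc.clm_apply continuous_const)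
      (hΨ.hasCompactSupport.fderiv_apply (𝕜 := ℝ) _)
  have i₂ : Integrable (fun Y => ⟪V Y, (fderiv ℝ Ψ Y) Y⟫) volume :=
    integrable_inner_of_locallyIntegrable_of_hasCompactSupport hV (hDΨc.clm_apply continuous_id)
      (hasCompactSupport_fderiv_apply_self hΨ)
  have hsplit : ∫ Y, c * ⟪V Y, (fderiv ℝ Ψ Y) (deriv ξ τ + (-(γ * (T - τ) ^ (γ - 1))) • Y)⟫ =
      c * ((∫ Y, ⟪V Y, (fderiv ℝ Ψ Y) (deriv ξ τ)⟫) + (-(γ * (T - τ) ^ (γ - 1))) * ∫ Y, ⟪V Y, (fderiv ℝ Ψ Y) Y⟫) := by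
    rw [integral_const_mul, ← integral_const_mul (-(γ * (T - τ) ^ (γ - 1))), ← integral_add i₁ (i₂.const_mul _)]
    congr 1
    refine integral_congr_ae (Eventually.of_forall fun Y => ?_)
    simp only [map_add, map_smul, inner_add_right, real_inner_smul_right]
  rw [hsplit, integral_const_mul] at key
  -- power algebra: divide by `(T−τ)^{4γ−2}`
  have e1 : (T - τ) ^ (5 * γ - 2) * c = (T - τ) ^ (4 * γ - 2) := by
    rw [hc, ← Real.rpow_add hl]; ring_nf
  have e2 : (T - τ) ^ (4 * γ - 1) * c = (T - τ) ^ (4 * γ - 2) * (T - τ) ^ (1 - γ) := by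
    rw [hc, ← Real.rpow_add hl, ← Real.rpow_add hl]; ring_nf
  have e3 : (T - τ) ^ (1 - γ) * (T - τ) ^ (γ - 1) = 1 := by
    rw [← Real.rpow_add hl]; norm_num
  have e4 : (T - τ) ^ (4 * γ - 1 - 1) = (T - τ) ^ (4 * γ - 2) := by ring_nf
  have hP : 0 < (T - τ) ^ (4 * γ - 2) := Real.rpow_pos_of_pos hl _
  set I₀ := ∫ Y, ⟪V Y, Ψ Y⟫
  set I₁ := ∫ Y, ⟪V Y, (fderiv ℝ Ψ Y) (deriv ξ τ)⟫
  set I₂ := ∫ Y, ⟪V Y, (fderiv ℝ Ψ Y) Y⟫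
  set I₃ := ∫ Y, ⟪V Y, (fderiv ℝ Ψ Y) (V Y)⟫
  -- `key : l^(5γ-2) * (c * I₃) = -1*(4γ-1)*l^(4γ-1-1) * I₀ + l^(4γ-1) * (c * (I₁ + d * I₂))`
  have key' : (T - τ) ^ (4 * γ - 2) * I₃ =
      (T - τ) ^ (4 * γ - 2) * (-(4 * γ - 1) * I₀ + (T - τ) ^ (1 - γ) * I₁ - γ * I₂) := by
    have h1 : (T - τ) ^ (5 * γ - 2) * (c * I₃) = (T - τ) ^ (4 * γ - 2) * I₃ := by rw [← mul_assoc, e1]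
    have h2 : (T - τ) ^ (4 * γ - 1) * (c * (I₁ + (-(γ * (T - τ) ^ (γ - 1))) * I₂)) =
        (T - τ) ^ (4 * γ - 2) * ((T - τ) ^ (1 - γ) * I₁ - γ * I₂) := by
      rw [← mul_assoc, e2]
      have : (T - τ) ^ (1 - γ) * (-(γ * (T - τ) ^ (γ - 1)) * I₂) = -(γ * I₂) := by
        calc (T - τ) ^ (1 - γ) * (-(γ * (T - τ) ^ (γ - 1)) * I₂)
            = -(γ * ((T - τ) ^ (1 - γ) * (T - τ) ^ (γ - 1)) * I₂) := by ring
          _ = -(γ * I₂) := by rw [e3, mul_one]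
      rw [mul_assoc, mul_add, this]; ring
    rw [h1, h2, e4] at key
    rw [key]; ring
  have := mul_left_cancel₀ hP.ne' key'
  rw [this]; ring

/-- **THE SIMILARITY DRIFT IS WEAKLY A GRADIENT ALONG ITS INCREMENTS.**  For a wandering member as above and `τ₁, τ₂ < T₁`, with the
similarity drift `d(τ) = (T−τ)^{1−γ} ξ'(τ)`: `∫ ⟪V, DΨ·(d(τ₁) − d(τ₂))⟫ = 0` for every divergence-free test field `Ψ` — the hypothesis
of `GalileanFrames.harmonicShearVanishes` for the profile `V` and the direction `d(τ₁) − d(τ₂)`. [folklore] -/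
theorem wandering_drift_weaklyGradient
    (hsol : IsDistributionalNSSolutionOn (slab (EuclideanSpace ℝ (Fin 3)) (Iio 0) isOpen_Iio) 0 0 u p)
    (hT₁ : T₁ ≤ 0) (hT : T₁ ≤ T) (hγ : 0 < γ) (hγ1 : γ ≤ 1) (hξ : ContDiff ℝ 1 ξ)
    (hVm : AEStronglyMeasurable V volume) (hV : LocallyIntegrable V volume)
    (hV2 : LocallyIntegrable (fun z => ‖V z‖ ^ 2) volume)
    (hu : ∀ τ : ℝ, τ < T₁ → u τ = fun y => (T - τ) ^ (γ - 1) • V ((T - τ) ^ (-γ) • (y - ξ τ)))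
    {Ψ : EuclideanSpace ℝ (Fin 3) → EuclideanSpace ℝ (Fin 3)} (hΨ : IsTestFunctionOn (⊤ : Opens (EuclideanSpace ℝ (Fin 3))) Ψ)
    (hdiv : ∀ z, VectorCalculus.divergence Ψ z = 0) {τ₁ τ₂ : ℝ} (hτ₁ : τ₁ < T₁) (hτ₂ : τ₂ < T₁) :
    ∫ Y, ⟪V Y, (fderiv ℝ Ψ Y) ((T - τ₁) ^ (1 - γ) • deriv ξ τ₁ - (T - τ₂) ^ (1 - γ) • deriv ξ τ₂)⟫ = 0 := by
  have i : ∀ v : EuclideanSpace ℝ (Fin 3), Integrable (fun Y => ⟪V Y, (fderiv ℝ Ψ Y) v⟫) volume := fun v =>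
    integrable_inner_of_locallyIntegrable_of_hasCompactSupport hV
      ((hΨ.contDiff.continuous_fderiv (by simp)).clm_apply continuous_const) (hΨ.hasCompactSupport.fderiv_apply (𝕜 := ℝ) v)
  have h1 := wandering_profile_identity hsol hT₁ hT hγ hγ1 hξ hVm hV hV2 hu hΨ hdiv hτ₁
  have h2 := wandering_profile_identity hsol hT₁ hT hγ hγ1 hξ hVm hV hV2 hu hΨ hdiv hτ₂
  simp_rw [map_sub, map_smul, inner_sub_right, real_inner_smul_right]
  rw [integral_sub ((i _).const_mul _) ((i _).const_mul _), integral_const_mul, integral_const_mul, ← h1, ← h2, sub_self]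

/-- **THE PROFILE OF A WANDERING MEMBER IS WEAKLY DIVERGENCE FREE**: `∫ ⟪V, ∇φ⟫ = 0` for every smooth compactly supported `φ`.
[folklore] -/
theorem wandering_profile_integral_inner_gradient_eq_zero
    (hsol : IsDistributionalNSSolutionOn (slab (EuclideanSpace ℝ (Fin 3)) (Iio 0) isOpen_Iio) 0 0 u p)
    (hT₁ : T₁ ≤ 0) (hT : T₁ ≤ T) (hγ : 0 < γ) (hγ1 : γ ≤ 1) (hξ : ContDiff ℝ 1 ξ) (hV : LocallyIntegrable V volume)
    (hu : ∀ τ : ℝ, τ < T₁ → u τ = fun y => (T - τ) ^ (γ - 1) • V ((T - τ) ^ (-γ) • (y - ξ τ)))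
    {φ : EuclideanSpace ℝ (Fin 3) → ℝ} (hφ : ContDiff ℝ (⊤ : ℕ∞) φ) (hφc : HasCompactSupport φ) :
    ∫ Y, ⟪V Y, gradient φ Y⟫ = 0 := by
  -- the shifted pairing vanishes at every `τ < T₁`, for every test function `ψ`
  have key : ∀ ψ : EuclideanSpace ℝ (Fin 3) → ℝ, IsTestFunctionOn (⊤ : Opens (EuclideanSpace ℝ (Fin 3))) ψ →
      ∀ t, t < T₁ → ∫ Y, ⟪V Y, gradient ψ (ξ t + (T - t) ^ γ • Y)⟫ = 0 := by
    intro ψ hψ t ht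
    have hG := isTestFunctionOn_gradient_field hψ
    set D : ℝ → ℝ := fun s => ∫ y, ⟪u s y, gradient ψ y⟫ with hD
    have hDs : ∀ s, s < T₁ → D s = (T - s) ^ (4 * γ - 1) * ∫ Y, ⟪V Y, gradient ψ (ξ s + (T - s) ^ γ • Y)⟫ := fun s hs => by
      simp only [hD]
      rw [hu s hs]
      exact integral_inner_wanderingSlice (hs.trans_le hT) (ξ s) (gradient ψ)
    have hpow : ContinuousOn (fun s : ℝ => (T - s) ^ (4 * γ - 1)) (Iio T) := fun s hs =>
      ((continuousAt_const.sub continuousAt_id).rpow_const (Or.inl (sub_pos.2 (show s < T from hs)).ne')).continuousWithinAt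
    have hGc : ContinuousOn (fun s : ℝ => ∫ Y, ⟪V Y, gradient ψ (ξ s + (T - s) ^ γ • Y)⟫) (Iio T) := fun s hs =>
      (hasDerivAt_wanderingPairing hV hξ hγ hγ1 hG (show s < T from hs)).continuousAt.continuousWithinAt
    have hDc : ContinuousOn D (Iio T₁) := ((hpow.mul hGc).mono (Iio_subset_Iio hT)).congr fun s hs => hDs s hs
    have h := eq_of_integral_deriv_mul_add_eq_zero_Iio (f := fun _ => (0 : ℝ)) (g := fun _ => (0 : ℝ)) (N := D)
      (fun s _ => hasDerivAt_const s (0 : ℝ)) continuousOn_const hDc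
      (fun χ hχ hχc hχT => by
        simp only [mul_zero, zero_add]
        exact integral_scalarTensorTest hsol hψ hχ hχc (hχT.trans (Iio_subset_Iio hT₁))) ht
    rw [hDs t ht] at h
    have hl : 0 < T - t := by linarith
    exact (mul_eq_zero.1 h).resolve_left (Real.rpow_pos_of_pos hl _).ne'
  -- pull back `φ` to the frame at `τ₀ = T₁ − 1`
  set t₀ : ℝ := T₁ - 1 with ht₀
  have ht₀T : t₀ < T₁ := by rw [ht₀]; linarith
  have hl : 0 < T - t₀ := by linarith
  set c : ℝ := (T - t₀) ^ (-γ) with hc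
  have hcs : c = ((T - t₀) ^ γ)⁻¹ := Real.rpow_neg hl.le γ
  have hspos : 0 < (T - t₀) ^ γ := Real.rpow_pos_of_pos hl _
  have hc0 : c ≠ 0 := by rw [hcs]; exact inv_ne_zero hspos.ne'
  have hφ' : IsTestFunctionOn (⊤ : Opens (EuclideanSpace ℝ (Fin 3))) (fun y => φ (c • (y - ξ t₀))) :=
    isTestFunctionOn_comp_smul_sub ⟨hφ, hφc, by simp⟩ hc0 (ξ t₀)
  have h := key _ hφ' t₀ ht₀T
  have hpt : ∀ Y : EuclideanSpace ℝ (Fin 3), c • (ξ t₀ + (T - t₀) ^ γ • Y - ξ t₀) = Y := fun Y => by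
    rw [add_sub_cancel_left, smul_smul, hcs, inv_mul_cancel₀ hspos.ne', one_smul]
  have hgr : ∀ Y, gradient (fun y => φ (c • (y - ξ t₀))) (ξ t₀ + (T - t₀) ^ γ • Y) = c • gradient φ Y := fun Y => by
    rw [gradient_comp_smul_sub (hφ.differentiable (by simp)) c (ξ t₀), hpt]
  simp only [hgr, real_inner_smul_right] at h
  rw [integral_const_mul] at h
  exact (mul_eq_zero.1 h).resolve_left hc0

end Member

end GalileanFrames

end Summit.NavierStokesRegularity.NavierStokesRegularity.Theorems.PowerGaugeEulerLiouville
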